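import Literature.Probability.Distributions.ExponentialLogMoment
import Mathlib.Analysis.SpecialFunctions.ImproperIntegrals
import Mathlib.Analysis.SpecialFunctions.Gamma.Basic
import Mathlib.MeasureTheory.Integral.IntegralEqImproper
import Mathlib.Analysis.SpecialFunctions.Log.NegMulLog
import HarnessLib

/-!
# RiemannHypothesis / LiAsymptotic — crux K2 `LiSmoothMainTerm`, stub K2a part 1: four Laplace transforms (RH-FREE)

RH-FREE [rh-li-prover].  Route `Theses/LiAsymptotic.lean` (rung L-P(P1⁺) «Li asymptotic law, quadratic range»,
cell `pub/rh-li`, theory memo `theory/TARGETS.md` §11.2 STEP 6 (6c)), item `LiSmoothMainTerm`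
(stmt-RiemannHypothesis-19162), registered birth stub `stub_modelIntegral` (K2a): the MODEL INTEGRAL
`(1/π)∫_0^∞ (1 − cos(n/t)) log(t/2π) dt = (n/2) log n + C₁ n` rests on `J₀ = ∫_0^∞ (1 − cos u) u⁻² du = π/2` and
`J₁ = ∫_0^∞ (1 − cos u) log u · u⁻² du = (π/2)(1 − γ)`.  Both follow (parts 2–3) from FUBINI against the Laplace
representation `u⁻² = ∫_0^∞ x e^{−ux} dx`, `u⁻² log u = ∫_0^∞ x((1 − γ) − log x) e^{−ux} dx`.  THIS FILE: the four
Laplace transforms on `(0, ∞)`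

* `∫ e^{−xu} du = 1/x`, `∫ cos u · e^{−xu} du = x/(1 + x²)` (so `∫ (1 − cos u) e^{−xu} du = 1/(x(1 + x²))`),
* `∫ x e^{−ux} dx = 1/u²`, `∫ x log x · e^{−ux} dx = (1 − γ − log u)/u²` (by parts from Boyadzhiev's
  `∫ log x · e^{−ux} dx = −(log u + γ)/u`, tree `integral_log_mul_exp_neg_mul_Ioi`),

with the integrability statements they need.  Classical analysis; nothing here bears on the truth of RH.
-/

noncomputable section

-- D-0017: `Summit.<S>.<S>.…` is the designed namespace of a single-problem summit.
set_option linter.dupNamespace false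

open MeasureTheory Set Filter Real
open scoped Topology

namespace Summit.RiemannHypothesis.RiemannHypothesis.Theorems.LiTheory

namespace ModelIntegral

/-! ### `∫ e^{−xu} du`, `∫ cos u e^{−xu} du` -/

/-- `∫_{(0,∞)} e^{−xu} du = 1/x` (`x > 0`). -/
theorem integral_exp_neg_mul {x : ℝ} (hx : 0 < x) : ∫ u in Ioi (0 : ℝ), Real.exp (-(x * u)) = 1 / x := by
  have h := integral_rpow_mul_exp_neg_mul_Ioi (a := 1) (r := x) one_pos hx
  simp only [sub_self, Real.rpow_zero, one_mul, Real.Gamma_one, mul_one] at h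
  rw [h, Real.rpow_one]

/-- `e^{−xu}` is integrable on `(0, ∞)` (`x > 0`). -/
theorem integrableOn_exp_neg_mul {x : ℝ} (hx : 0 < x) :
    IntegrableOn (fun u : ℝ ↦ Real.exp (-(x * u))) (Ioi 0) := by
  have h := exp_neg_integrableOn_Ioi 0 hx
  refine h.congr_fun (fun u _ ↦ ?_) measurableSet_Ioi
  ring_nf

/-- `cos u · e^{−xu} = Re e^{(−x + i)u}`. -/
theorem cos_mul_exp_eq_re (x u : ℝ) :
    Real.cos u * Real.exp (-(x * u)) = (Complex.exp ((-(x : ℂ) + Complex.I) * u)).re := by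
  rw [Complex.exp_re]
  have hre : ((-(x : ℂ) + Complex.I) * u).re = -(x * u) := by simp
  have him : ((-(x : ℂ) + Complex.I) * u).im = u := by simp
  rw [hre, him, mul_comm]

/-- `cos u · e^{−xu}` is integrable on `(0, ∞)` (`x > 0`). -/
theorem integrableOn_cos_mul_exp_neg_mul {x : ℝ} (hx : 0 < x) :
    IntegrableOn (fun u : ℝ ↦ Real.cos u * Real.exp (-(x * u))) (Ioi 0) := by
  have ha : (-(x : ℂ) + Complex.I).re < 0 := by simp [hx]
  have h : IntegrableOn (fun u : ℝ ↦ (Complex.exp ((-(x : ℂ) + Complex.I) * u)).re) (Ioi 0) :=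
    (integrableOn_exp_mul_complex_Ioi ha 0).re
  exact h.congr_fun (fun u _ ↦ (cos_mul_exp_eq_re x u).symm) measurableSet_Ioi

/-- `∫_{(0,∞)} cos u · e^{−xu} du = x/(1 + x²)` (`x > 0`). -/
theorem integral_cos_mul_exp_neg_mul {x : ℝ} (hx : 0 < x) :
    ∫ u in Ioi (0 : ℝ), Real.cos u * Real.exp (-(x * u)) = x / (1 + x ^ 2) := by
  set a : ℂ := -(x : ℂ) + Complex.I with ha_def
  have ha : a.re < 0 := by simp [ha_def, hx]
  have hint := integrableOn_exp_mul_complex_Ioi ha 0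
  have hval := integral_exp_mul_complex_Ioi ha 0
  simp only [Complex.ofReal_zero, mul_zero, Complex.exp_zero] at hval
  have hre : ∫ u in Ioi (0 : ℝ), (Complex.exp (a * u)).re = (∫ u in Ioi (0 : ℝ), Complex.exp (a * u)).re := by
    have := ContinuousLinearMap.integral_comp_comm Complex.reCLM hint
    simpa using this
  calc ∫ u in Ioi (0 : ℝ), Real.cos u * Real.exp (-(x * u)) = ∫ u in Ioi (0 : ℝ), (Complex.exp (a * u)).re :=
        setIntegral_congr_fun measurableSet_Ioi fun u _ ↦ cos_mul_exp_eq_re x u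
    _ = (∫ u in Ioi (0 : ℝ), Complex.exp (a * u)).re := hre
    _ = x / (1 + x ^ 2) := by
        rw [hval, neg_div, Complex.neg_re, one_div, Complex.inv_re]
        have hns : Complex.normSq a = 1 + x ^ 2 := by
          rw [Complex.normSq_apply]; simp [ha_def]; ring
        rw [hns]; simp [ha_def]; ring

/-- `∫_{(0,∞)} (1 − cos u) e^{−xu} du = 1/(x(1 + x²))` (`x > 0`). -/
theorem integral_one_sub_cos_mul_exp {x : ℝ} (hx : 0 < x) :
    ∫ u in Ioi (0 : ℝ), (1 - Real.cos u) * Real.exp (-(x * u)) = 1 / (x * (1 + x ^ 2)) := by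
  have e : ∀ u : ℝ, (1 - Real.cos u) * Real.exp (-(x * u)) = Real.exp (-(x * u)) - Real.cos u * Real.exp (-(x * u)) :=
    fun u ↦ by ring
  simp_rw [e]
  rw [integral_sub (integrableOn_exp_neg_mul hx) (integrableOn_cos_mul_exp_neg_mul hx), integral_exp_neg_mul hx,
    integral_cos_mul_exp_neg_mul hx]
  field_simp
  ring

/-- `(1 − cos u) e^{−xu}` is integrable on `(0, ∞)` and nonnegative. -/
theorem integrableOn_one_sub_cos_mul_exp {x : ℝ} (hx : 0 < x) :
    IntegrableOn (fun u : ℝ ↦ (1 - Real.cos u) * Real.exp (-(x * u))) (Ioi 0) := by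
  have e : (fun u : ℝ ↦ (1 - Real.cos u) * Real.exp (-(x * u))) =
      fun u ↦ Real.exp (-(x * u)) - Real.cos u * Real.exp (-(x * u)) := funext fun u ↦ by ring
  rw [e]
  exact (integrableOn_exp_neg_mul hx).sub (integrableOn_cos_mul_exp_neg_mul hx)

/-! ### `∫ x e^{−ux} dx`, `∫ x log x · e^{−ux} dx` -/

/-- `∫_{(0,∞)} x e^{−ux} dx = 1/u²` (`u > 0`). -/
theorem integral_id_mul_exp_neg_mul {u : ℝ} (hu : 0 < u) : ∫ x in Ioi (0 : ℝ), x * Real.exp (-(u * x)) = 1 / u ^ 2 := by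
  have h := integral_rpow_mul_exp_neg_mul_Ioi (a := 2) (r := u) two_pos hu
  have e : ∀ x : ℝ, x ^ ((2 : ℝ) - 1) * Real.exp (-(u * x)) = x * Real.exp (-(u * x)) := fun x ↦ by norm_num
  simp_rw [e] at h
  rw [h, Real.Gamma_two]
  norm_num

/-- `x e^{−ux}` is integrable on `(0, ∞)` (`u > 0`). -/
theorem integrableOn_id_mul_exp_neg_mul {u : ℝ} (hu : 0 < u) :
    IntegrableOn (fun x : ℝ ↦ x * Real.exp (-(u * x))) (Ioi 0) := by
  refine Integrable.of_integral_ne_zero ?_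
  rw [integral_id_mul_exp_neg_mul hu]; positivity

/-- `x² e^{−ux}` is integrable on `(0, ∞)` (`u > 0`). -/
theorem integrableOn_sq_mul_exp_neg_mul {u : ℝ} (hu : 0 < u) :
    IntegrableOn (fun x : ℝ ↦ x ^ 2 * Real.exp (-(u * x))) (Ioi 0) := by
  have h := integral_rpow_mul_exp_neg_mul_Ioi (a := 3) (r := u) (by norm_num) hu
  have e : ∀ x : ℝ, x ^ ((3 : ℝ) - 1) * Real.exp (-(u * x)) = x ^ 2 * Real.exp (-(u * x)) := fun x ↦ by norm_num
  simp_rw [e] at h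
  refine Integrable.of_integral_ne_zero ?_
  rw [h]
  have := Real.Gamma_pos_of_pos (by norm_num : (0 : ℝ) < 3)
  positivity

/-- `log x · e^{−ux}` is integrable on `(0, ∞)` (`u > 0`; scaled from the tree's `u = 1` case). -/
theorem integrableOn_log_mul_exp_neg_mul {u : ℝ} (hu : 0 < u) :
    IntegrableOn (fun x : ℝ ↦ Real.log x * Real.exp (-(u * x))) (Ioi 0) := by
  have h1 : IntegrableOn (fun x : ℝ ↦ Real.log (u * x) * Real.exp (-(u * x))) (Ioi 0) := by
    have h := (integrableOn_Ioi_comp_mul_left_iff (fun t : ℝ ↦ Real.log t * Real.exp (-t)) 0 hu).2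
    rw [mul_zero] at h
    exact h Literature.Probability.Distributions.integrableOn_log_mul_exp_neg_Ioi
  have h2 : IntegrableOn (fun x : ℝ ↦ Real.log u * Real.exp (-(u * x))) (Ioi 0) :=
    (integrableOn_exp_neg_mul hu).const_mul _
  refine (h1.sub h2).congr_fun (fun x hx ↦ ?_) measurableSet_Ioi
  simp only [Pi.sub_apply]
  rw [Real.log_mul hu.ne' (mem_Ioi.1 hx).ne']
  ring

/-- `|x log x| ≤ x² + 1` for `x > 0`. -/
theorem abs_mul_log_le {x : ℝ} (hx : 0 < x) : |x * Real.log x| ≤ x ^ 2 + 1 := by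
  rcases le_or_gt x 1 with h1 | h1
  · have := Real.abs_log_mul_self_lt x hx h1
    rw [mul_comm] at this; nlinarith [sq_nonneg x]
  · have hl : Real.log x ≤ x := (Real.log_le_sub_one_of_pos hx).trans (by linarith)
    have hl0 : 0 ≤ Real.log x := Real.log_nonneg h1.le
    rw [abs_of_nonneg (mul_nonneg hx.le hl0)]; nlinarith

/-- `x log x · e^{−ux}` is integrable on `(0, ∞)` (`u > 0`). -/
theorem integrableOn_id_mul_log_mul_exp_neg_mul {u : ℝ} (hu : 0 < u) :
    IntegrableOn (fun x : ℝ ↦ x * Real.log x * Real.exp (-(u * x))) (Ioi 0) := by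
  have hdom : IntegrableOn (fun x : ℝ ↦ (x ^ 2 + 1) * Real.exp (-(u * x))) (Ioi 0) := by
    have e : (fun x : ℝ ↦ (x ^ 2 + 1) * Real.exp (-(u * x))) =
        fun x ↦ x ^ 2 * Real.exp (-(u * x)) + Real.exp (-(u * x)) := funext fun x ↦ by ring
    rw [e]; exact (integrableOn_sq_mul_exp_neg_mul hu).add (integrableOn_exp_neg_mul hu)
  refine Integrable.mono' hdom ?_ ?_
  · exact ((Real.continuous_mul_log.mul (Real.continuous_exp.comp (by fun_prop))).aestronglyMeasurable).restrict
  · filter_upwards [ae_restrict_mem measurableSet_Ioi] with x hx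
    rw [Real.norm_eq_abs, abs_mul (x * Real.log x), Real.abs_exp]
    exact mul_le_mul_of_nonneg_right (abs_mul_log_le (mem_Ioi.1 hx)) (Real.exp_pos _).le

/-- `∫_{(0,∞)} x log x · e^{−ux} dx = (1 − γ − log u)/u²` (`u > 0`): by parts against `−e^{−ux}/u`, then
Boyadzhiev's `∫ log x · e^{−ux} dx = −(log u + γ)/u` and `∫ e^{−ux} dx = 1/u`. -/
theorem integral_id_mul_log_mul_exp_neg_mul {u : ℝ} (hu : 0 < u) :
    ∫ x in Ioi (0 : ℝ), x * Real.log x * Real.exp (-(u * x)) =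
      (1 - Real.eulerMascheroniConstant - Real.log u) / u ^ 2 := by
  set U : ℝ → ℝ := fun x ↦ x * Real.log x with hUdef
  set U' : ℝ → ℝ := fun x ↦ Real.log x + 1 with hU'def
  set V : ℝ → ℝ := fun x ↦ -(Real.exp (-(u * x)) / u) with hVdef
  set V' : ℝ → ℝ := fun x ↦ Real.exp (-(u * x)) with hV'def
  have hU : ∀ x ∈ Ioi (0 : ℝ), HasDerivAt U (U' x) x := fun x hx ↦ Real.hasDerivAt_mul_log (mem_Ioi.1 hx).ne'
  have hexp : ∀ x : ℝ, HasDerivAt (fun y : ℝ ↦ Real.exp (-(u * y))) (Real.exp (-(u * x)) * (-u)) x := by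
    intro x
    have h := ((hasDerivAt_id x).const_mul u).neg.exp
    simpa using h
  have hV : ∀ x ∈ Ioi (0 : ℝ), HasDerivAt V (V' x) x := by
    intro x _
    refine ((hexp x).div_const u).neg.congr_deriv ?_
    simp only [hV'def]
    field_simp
  -- integrability of `U V'`
  have huv' : IntegrableOn (U * V') (Ioi 0) :=
    (integrableOn_id_mul_log_mul_exp_neg_mul hu).congr_fun (fun x _ ↦ by simp [hUdef, hV'def]) measurableSet_Ioi
  -- integrability of `U' V`
  have hu'v : IntegrableOn (U' * V) (Ioi 0) := by
    have h : IntegrableOn (fun x : ℝ ↦ -(1 / u) * (Real.log x * Real.exp (-(u * x)) + Real.exp (-(u * x)))) (Ioi 0) :=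
      ((integrableOn_log_mul_exp_neg_mul hu).add (integrableOn_exp_neg_mul hu)).const_mul (-(1 / u))
    refine h.congr_fun (fun x _ ↦ ?_) measurableSet_Ioi
    simp only [Pi.mul_apply, hU'def, hVdef]
    ring
  -- boundary values
  have h_zero : Tendsto (U * V) (𝓝[>] (0 : ℝ)) (𝓝 0) := by
    have hc : Continuous (U * V) :=
      Real.continuous_mul_log.mul ((Real.continuous_exp.comp (by fun_prop)).div_const u).neg
    have h0 : (U * V) 0 = 0 := by simp [hUdef]
    simpa [h0] using (hc.tendsto 0).mono_left nhdsWithin_le_nhds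
  have h_infty : Tendsto (U * V) atTop (𝓝 0) := by
    have hg : Tendsto (fun x : ℝ ↦ (u * x) ^ 2 * Real.exp (-(u * x))) atTop (𝓝 0) :=
      (Real.tendsto_pow_mul_exp_neg_atTop_nhds_zero 2).comp (tendsto_id.const_mul_atTop hu)
    have hg' : Tendsto (fun x : ℝ ↦ (1 / u ^ 3) * ((u * x) ^ 2 * Real.exp (-(u * x)))) atTop (𝓝 0) := by
      have := hg.const_mul (1 / u ^ 3); rwa [mul_zero] at this
    refine squeeze_zero_norm' ?_ hg'
    filter_upwards [eventually_ge_atTop (1 : ℝ)] with x hx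
    have hx0 : 0 < x := by linarith
    have hl : Real.log x ≤ x := (Real.log_le_sub_one_of_pos hx0).trans (by linarith)
    have hl0 : 0 ≤ Real.log x := Real.log_nonneg hx
    simp only [Pi.mul_apply, hUdef, hVdef, Real.norm_eq_abs]
    rw [show x * Real.log x * -(Real.exp (-(u * x)) / u) = -(x * Real.log x * Real.exp (-(u * x)) / u) by ring,
      abs_neg, abs_of_nonneg (by positivity)]
    rw [div_le_iff₀ hu, show 1 / u ^ 3 * ((u * x) ^ 2 * Real.exp (-(u * x))) * u = x ^ 2 * Real.exp (-(u * x)) by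
      field_simp]
    exact mul_le_mul_of_nonneg_right (by nlinarith) (Real.exp_pos _).le
  -- by parts
  have hparts := integral_Ioi_mul_deriv_eq_deriv_mul hU hV huv' hu'v h_zero h_infty
  have hlhs : ∫ x in Ioi (0 : ℝ), x * Real.log x * Real.exp (-(u * x)) = ∫ x in Ioi (0 : ℝ), U x * V' x :=
    setIntegral_congr_fun measurableSet_Ioi fun x _ ↦ by simp [hUdef, hV'def]
  have hrhs : ∫ x in Ioi (0 : ℝ), U' x * V x =
      -(1 / u) * ((∫ x in Ioi (0 : ℝ), Real.log x * Real.exp (-(u * x))) + ∫ x in Ioi (0 : ℝ), Real.exp (-(u * x))) := by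
    rw [← integral_add (integrableOn_log_mul_exp_neg_mul hu) (integrableOn_exp_neg_mul hu), ← integral_const_mul]
    refine setIntegral_congr_fun measurableSet_Ioi fun x _ ↦ ?_
    simp only [hU'def, hVdef]
    ring
  rw [hlhs, hparts, hrhs, Literature.Probability.Distributions.integral_log_mul_exp_neg_mul_Ioi hu,
    integral_exp_neg_mul hu]
  field_simp
  ring

end ModelIntegral

end Summit.RiemannHypothesis.RiemannHypothesis.Theorems.LiTheory

end
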